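import Mathlib
import Summits.Ventures.PercRepro2.CaseOneTwoMarkD
import Summits.Ventures.PercRepro2.HalfLTwoMarkPoly

/-!
# The masses of the `L`-half for `a₃ ~ {o, b}` in the nine cells (blind cell PercRepro2, night-1 g37)

Base law `p[eo ↦ 0][eb ↦ 0]` (both edges at `a₃` closed), base events `Q₀ = {a₁ ↮ a₂}`, `O₁ = {a₁ ↔ o}`,
`O₂ = {a₂ ↔ o}`, `B₁ = {a₁ ↔ b}`, `B₂ = {a₂ ↔ b}`; the nine cells `cellsOf p … : Cells R` are the base
probabilities of `Q₀ ∩ {o ∈ X} ∩ {b ∈ Y}`, `X, Y ∈ {L, H, N}`.  By p1's double pinning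
(`CaseOne.prob_twoPin`) and the pointwise descriptions `conn_open_o_iff`, `conn_open_b_iff`,
`conn_both_iff`, `conn_both_a3_iff` (isolated / leaf / bridge), each of the ten masses of
`HalfLTwoMark.lhs` is the corresponding polynomial of `HalfLTwoMarkPoly` in `p eo`, `p eb` and the cells:
this file has the cells, the cell decompositions of the base law (`split_o`, `split_b`, `total_cells`) and
the first five masses (`mass_Q`, `mass_bL`, `mass_T`, `mass_TbL`, `mass_TbLoU`); `HalfLTwoMarkMassesB` has the
other five (`mass_oH`, `mass_bLoH`, `mass_ToU`, `mass_PD`, `mass_PDoU`).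
-/

namespace Summit.Ventures.PercRepro2

namespace HalfLTwoMark

open CaseOne

section Cells

variable {V : Type*} {E : Type*} [Fintype E] [DecidableEq E] {R : Type*} [CommRing R]

/-- The nine cells of the base law `p[eo ↦ 0][eb ↦ 0]`. -/
noncomputable def cellsOf (p : E → R) (ends : E → Sym2 V) (o a₁ a₂ b : V) (eo eb : E) : Cells R where
  LL := prob (Function.update (Function.update p eo 0) eb 0)
    ((connEvent ends a₁ a₂)ᶜ ∩ connEvent ends a₁ o ∩ connEvent ends a₁ b)
  LH := prob (Function.update (Function.update p eo 0) eb 0)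
    ((connEvent ends a₁ a₂)ᶜ ∩ connEvent ends a₁ o ∩ connEvent ends a₂ b)
  LN := prob (Function.update (Function.update p eo 0) eb 0)
    ((connEvent ends a₁ a₂)ᶜ ∩ connEvent ends a₁ o ∩ (connEvent ends a₁ b ∪ connEvent ends a₂ b)ᶜ)
  HL := prob (Function.update (Function.update p eo 0) eb 0)
    ((connEvent ends a₁ a₂)ᶜ ∩ connEvent ends a₂ o ∩ connEvent ends a₁ b)
  HH := prob (Function.update (Function.update p eo 0) eb 0)
    ((connEvent ends a₁ a₂)ᶜ ∩ connEvent ends a₂ o ∩ connEvent ends a₂ b)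
  HN := prob (Function.update (Function.update p eo 0) eb 0)
    ((connEvent ends a₁ a₂)ᶜ ∩ connEvent ends a₂ o ∩ (connEvent ends a₁ b ∪ connEvent ends a₂ b)ᶜ)
  NL := prob (Function.update (Function.update p eo 0) eb 0)
    ((connEvent ends a₁ a₂)ᶜ ∩ (connEvent ends a₁ o ∪ connEvent ends a₂ o)ᶜ ∩ connEvent ends a₁ b)
  NH := prob (Function.update (Function.update p eo 0) eb 0)
    ((connEvent ends a₁ a₂)ᶜ ∩ (connEvent ends a₁ o ∪ connEvent ends a₂ o)ᶜ ∩ connEvent ends a₂ b)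
  NN := prob (Function.update (Function.update p eo 0) eb 0)
    ((connEvent ends a₁ a₂)ᶜ ∩ (connEvent ends a₁ o ∪ connEvent ends a₂ o)ᶜ ∩
      (connEvent ends a₁ b ∪ connEvent ends a₂ b)ᶜ)

omit [Fintype E] [DecidableEq E] in
/-- Under `Q₀`, a vertex is in at most one root cluster. -/
lemma not_both {ends : E → Sym2 V} {ω : Config E} {a₁ a₂ x : V} (hq : ¬ Conn ends ω a₁ a₂)
    (h1 : Conn ends ω a₁ x) (h2 : Conn ends ω a₂ x) : False :=
  hq (conn_trans h1 (conn_symm h2))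

/-- **The `o`-split of the base law**: `P(Q₀ ∩ X) = P(Q₀ ∩ O₁ ∩ X) + P(Q₀ ∩ O₂ ∩ X) + P(Q₀ ∩ (O₁ ∪ O₂)ᶜ ∩ X)`. -/
lemma split_o (p : E → R) (ends : E → Sym2 V) (o a₁ a₂ : V) (X : Set (Config E)) :
    prob p ((connEvent ends a₁ a₂)ᶜ ∩ X) =
      prob p ((connEvent ends a₁ a₂)ᶜ ∩ connEvent ends a₁ o ∩ X) +
        prob p ((connEvent ends a₁ a₂)ᶜ ∩ connEvent ends a₂ o ∩ X) +
        prob p ((connEvent ends a₁ a₂)ᶜ ∩ (connEvent ends a₁ o ∪ connEvent ends a₂ o)ᶜ ∩ X) := by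
  have s := prob_inter_add_prob_inter_compl p ((connEvent ends a₁ a₂)ᶜ ∩ X)
    (connEvent ends a₁ o ∪ connEvent ends a₂ o)
  have e : (connEvent ends a₁ a₂)ᶜ ∩ X ∩ (connEvent ends a₁ o ∪ connEvent ends a₂ o) =
      ((connEvent ends a₁ a₂)ᶜ ∩ connEvent ends a₁ o ∩ X) ∪
        ((connEvent ends a₁ a₂)ᶜ ∩ connEvent ends a₂ o ∩ X) := by
    ext ω
    simp only [Set.mem_inter_iff, Set.mem_union, Set.mem_compl_iff, mem_connEvent]
    tauto
  have d : Disjoint ((connEvent ends a₁ a₂)ᶜ ∩ connEvent ends a₁ o ∩ X)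
      ((connEvent ends a₁ a₂)ᶜ ∩ connEvent ends a₂ o ∩ X) :=
    Set.disjoint_left.2 fun ω h1 h2 => not_both h1.1.1 h1.1.2 h2.1.2
  have e2 : (connEvent ends a₁ a₂)ᶜ ∩ X ∩ (connEvent ends a₁ o ∪ connEvent ends a₂ o)ᶜ =
      (connEvent ends a₁ a₂)ᶜ ∩ (connEvent ends a₁ o ∪ connEvent ends a₂ o)ᶜ ∩ X :=
    Set.inter_right_comm _ _ _
  rw [e, prob_union_of_disjoint p d, e2] at s
  exact s.symm

/-- **The `b`-split of the base law**: `P(Q₀ ∩ Y) = P(Q₀ ∩ Y ∩ B₁) + P(Q₀ ∩ Y ∩ B₂) + P(Q₀ ∩ Y ∩ (B₁ ∪ B₂)ᶜ)`. -/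
lemma split_b (p : E → R) (ends : E → Sym2 V) (b a₁ a₂ : V) (Y : Set (Config E)) :
    prob p ((connEvent ends a₁ a₂)ᶜ ∩ Y) =
      prob p ((connEvent ends a₁ a₂)ᶜ ∩ Y ∩ connEvent ends a₁ b) +
        prob p ((connEvent ends a₁ a₂)ᶜ ∩ Y ∩ connEvent ends a₂ b) +
        prob p ((connEvent ends a₁ a₂)ᶜ ∩ Y ∩ (connEvent ends a₁ b ∪ connEvent ends a₂ b)ᶜ) := by
  have s := prob_inter_add_prob_inter_compl p ((connEvent ends a₁ a₂)ᶜ ∩ Y)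
    (connEvent ends a₁ b ∪ connEvent ends a₂ b)
  have e : (connEvent ends a₁ a₂)ᶜ ∩ Y ∩ (connEvent ends a₁ b ∪ connEvent ends a₂ b) =
      ((connEvent ends a₁ a₂)ᶜ ∩ Y ∩ connEvent ends a₁ b) ∪
        ((connEvent ends a₁ a₂)ᶜ ∩ Y ∩ connEvent ends a₂ b) := by
    ext ω
    simp only [Set.mem_inter_iff, Set.mem_union, Set.mem_compl_iff, mem_connEvent]
    tauto
  have d : Disjoint ((connEvent ends a₁ a₂)ᶜ ∩ Y ∩ connEvent ends a₁ b)
      ((connEvent ends a₁ a₂)ᶜ ∩ Y ∩ connEvent ends a₂ b) :=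
    Set.disjoint_left.2 fun ω h1 h2 => not_both h1.1.1 h1.2 h2.2
  rw [e, prob_union_of_disjoint p d] at s
  exact s.symm


/-- **The total mass**: `P(Q₀)` is the sum of the nine cells. -/
lemma total_cells (p : E → R) (ends : E → Sym2 V) (o b a₁ a₂ : V) :
    prob p (connEvent ends a₁ a₂)ᶜ =
      prob p ((connEvent ends a₁ a₂)ᶜ ∩ connEvent ends a₁ o ∩ connEvent ends a₁ b) +
        prob p ((connEvent ends a₁ a₂)ᶜ ∩ connEvent ends a₁ o ∩ connEvent ends a₂ b) +
        prob p ((connEvent ends a₁ a₂)ᶜ ∩ connEvent ends a₁ o ∩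
          (connEvent ends a₁ b ∪ connEvent ends a₂ b)ᶜ) +
        prob p ((connEvent ends a₁ a₂)ᶜ ∩ connEvent ends a₂ o ∩ connEvent ends a₁ b) +
        prob p ((connEvent ends a₁ a₂)ᶜ ∩ connEvent ends a₂ o ∩ connEvent ends a₂ b) +
        prob p ((connEvent ends a₁ a₂)ᶜ ∩ connEvent ends a₂ o ∩
          (connEvent ends a₁ b ∪ connEvent ends a₂ b)ᶜ) +
        prob p ((connEvent ends a₁ a₂)ᶜ ∩ (connEvent ends a₁ o ∪ connEvent ends a₂ o)ᶜ ∩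
          connEvent ends a₁ b) +
        prob p ((connEvent ends a₁ a₂)ᶜ ∩ (connEvent ends a₁ o ∪ connEvent ends a₂ o)ᶜ ∩
          connEvent ends a₂ b) +
        prob p ((connEvent ends a₁ a₂)ᶜ ∩ (connEvent ends a₁ o ∪ connEvent ends a₂ o)ᶜ ∩
          (connEvent ends a₁ b ∪ connEvent ends a₂ b)ᶜ) := by
  have s := split_o p ends o a₁ a₂ Set.univ
  simp only [Set.inter_univ] at s
  have s1 := split_b p ends b a₁ a₂ (connEvent ends a₁ o)
  have s2 := split_b p ends b a₁ a₂ (connEvent ends a₂ o)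
  have s3 := split_b p ends b a₁ a₂ (connEvent ends a₁ o ∪ connEvent ends a₂ o)ᶜ
  linear_combination s + s1 + s2 + s3

end Cells

section Masses

variable {V : Type*} {E : Type*} [Fintype E] [DecidableEq E] {R : Type*} [CommRing R]
variable {ends : E → Sym2 V} {o b a₃ : V} {eo eb : E}

/-- **`P(Q, b ∈ L)`** for `a₃ ~ {o, b}`. -/
theorem mass_bL (p : E → R) (h : IsTwoMarkAt ends o b a₃ eo eb) {a₁ a₂ : V} (h1 : a₁ ≠ a₃)
    (h2 : a₂ ≠ a₃) :
    prob p ((connEvent ends a₁ a₂)ᶜ ∩ connEvent ends a₁ b) =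
      mbL (p eo) (p eb) (cellsOf p ends o a₁ a₂ b eo eb) := by
  set p00 := Function.update (Function.update p eo 0) eb 0 with hp00
  have key := prob_twoPin p h.ne ((connEvent ends a₁ a₂)ᶜ ∩ connEvent ends a₁ b)
    (((connEvent ends a₁ a₂)ᶜ ∩ connEvent ends a₁ o ∩ (connEvent ends a₂ b)ᶜ) ∪
      ((connEvent ends a₁ a₂)ᶜ ∩ (connEvent ends a₁ o ∪ connEvent ends a₂ o)ᶜ ∩ connEvent ends a₁ b))
    ((connEvent ends a₁ a₂)ᶜ ∩ connEvent ends a₁ b) ((connEvent ends a₁ a₂)ᶜ ∩ connEvent ends a₁ b)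
    ((connEvent ends a₁ a₂)ᶜ ∩ connEvent ends a₁ b) ?_ ?_ ?_ ?_
  · rw [key]
    unfold mbL cellsOf
    dsimp only
    rw [← hp00]
    have d : Disjoint ((connEvent ends a₁ a₂)ᶜ ∩ connEvent ends a₁ o ∩ (connEvent ends a₂ b)ᶜ)
        ((connEvent ends a₁ a₂)ᶜ ∩ (connEvent ends a₁ o ∪ connEvent ends a₂ o)ᶜ ∩ connEvent ends a₁ b) :=
      Set.disjoint_left.2 fun ω h1 h2 => h2.1.2 (Or.inl h1.1.2)
    rw [prob_union_of_disjoint p00 d]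
    have c1 := prob_inter_add_prob_inter_compl p00 ((connEvent ends a₁ a₂)ᶜ ∩ connEvent ends a₁ o)
      (connEvent ends a₂ b)
    have sb := split_b p00 ends b a₁ a₂ (connEvent ends a₁ o)
    have so := split_o p00 ends o a₁ a₂ (connEvent ends a₁ b)
    linear_combination (p eo * p eb) * (c1 + sb) + (1 - p eo * p eb) * so
  · intro ω ho hb
    rw [openCC_tt ho hb]
    simp only [Set.mem_compl_iff, Set.mem_inter_iff, Set.mem_union, mem_connEvent]
    rw [conn_both_iff h ω h1 h2, conn_both_iff h ω h1 h.ne_b, base2_eq_self ho hb,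
      conn_comm_iff ω b a₂, conn_comm_iff ω o a₂]
    have hbb := conn_refl ends ω b
    have t1 : Conn ends ω a₁ o → Conn ends ω a₂ o → Conn ends ω a₁ a₂ :=
      fun x y => conn_trans x (conn_symm y)
    have t2 : Conn ends ω a₁ b → Conn ends ω a₂ b → Conn ends ω a₁ a₂ :=
      fun x y => conn_trans x (conn_symm y)
    tauto
  · intro ω ho hb
    rw [openCC_tf h.ne ho hb]
    simp only [Set.mem_compl_iff, Set.mem_inter_iff, mem_connEvent]
    rw [conn_open_o_iff h ω h1 h2, conn_open_o_iff h ω h1 h.ne_b, base2_eq_self ho hb]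
  · intro ω ho hb
    rw [openCC_ft ho hb]
    simp only [Set.mem_compl_iff, Set.mem_inter_iff, mem_connEvent]
    rw [conn_open_b_iff h ω h1 h2, conn_open_b_iff h ω h1 h.ne_b, base2_eq_self ho hb]
  · intro ω ho hb
    rw [openCC_ff ho hb, base2_eq_self ho hb]


/-- **`P(Q)`** for `a₃ ~ {o, b}`: `M − r₁ r₂ (LH + HL)`. -/
theorem mass_Q (p : E → R) (h : IsTwoMarkAt ends o b a₃ eo eb) {a₁ a₂ : V} (h1 : a₁ ≠ a₃)
    (h2 : a₂ ≠ a₃) :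
    prob p (connEvent ends a₁ a₂)ᶜ = mQ (p eo) (p eb) (cellsOf p ends o a₁ a₂ b eo eb) := by
  set p00 := Function.update (Function.update p eo 0) eb 0 with hp00
  have key := prob_twoPin p h.ne (connEvent ends a₁ a₂)ᶜ
    ((connEvent ends a₁ a₂)ᶜ ∩
      ((connEvent ends a₁ o ∩ connEvent ends a₂ b) ∪ (connEvent ends a₂ o ∩ connEvent ends a₁ b))ᶜ)
    (connEvent ends a₁ a₂)ᶜ (connEvent ends a₁ a₂)ᶜ (connEvent ends a₁ a₂)ᶜ ?_ ?_ ?_ ?_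
  · rw [key]
    unfold mQ cellsOf
    dsimp only
    rw [← hp00]
    have c := prob_inter_add_prob_inter_compl p00 (connEvent ends a₁ a₂)ᶜ
      ((connEvent ends a₁ o ∩ connEvent ends a₂ b) ∪ (connEvent ends a₂ o ∩ connEvent ends a₁ b))
    have e : (connEvent ends a₁ a₂)ᶜ ∩
        ((connEvent ends a₁ o ∩ connEvent ends a₂ b) ∪ (connEvent ends a₂ o ∩ connEvent ends a₁ b)) =
        ((connEvent ends a₁ a₂)ᶜ ∩ connEvent ends a₁ o ∩ connEvent ends a₂ b) ∪
          ((connEvent ends a₁ a₂)ᶜ ∩ connEvent ends a₂ o ∩ connEvent ends a₁ b) := by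
      ext ω
      simp only [Set.mem_inter_iff, Set.mem_union, Set.mem_compl_iff, mem_connEvent]
      tauto
    have d : Disjoint ((connEvent ends a₁ a₂)ᶜ ∩ connEvent ends a₁ o ∩ connEvent ends a₂ b)
        ((connEvent ends a₁ a₂)ᶜ ∩ connEvent ends a₂ o ∩ connEvent ends a₁ b) :=
      Set.disjoint_left.2 fun ω h1 h2 => not_both h1.1.1 h1.1.2 h2.1.2
    rw [e, prob_union_of_disjoint p00 d] at c
    have tot := total_cells p00 ends o b a₁ a₂
    linear_combination (p eo * p eb) * c + tot
  · intro ω ho hb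
    rw [openCC_tt ho hb]
    simp only [Set.mem_compl_iff, Set.mem_inter_iff, Set.mem_union, mem_connEvent]
    rw [conn_both_iff h ω h1 h2, base2_eq_self ho hb, conn_comm_iff ω b a₂, conn_comm_iff ω o a₂]
    tauto
  · intro ω ho hb
    rw [openCC_tf h.ne ho hb]
    simp only [Set.mem_compl_iff, mem_connEvent]
    rw [conn_open_o_iff h ω h1 h2, base2_eq_self ho hb]
  · intro ω ho hb
    rw [openCC_ft ho hb]
    simp only [Set.mem_compl_iff, mem_connEvent]
    rw [conn_open_b_iff h ω h1 h2, base2_eq_self ho hb]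
  · intro ω ho hb
    rw [openCC_ff ho hb, base2_eq_self ho hb]

/-- **`P(T) = P(Q, a₃ ∈ H)`** for `a₃ ~ {o, b}`. -/
theorem mass_T (p : E → R) (h : IsTwoMarkAt ends o b a₃ eo eb) {a₁ a₂ : V} (h1 : a₁ ≠ a₃)
    (h2 : a₂ ≠ a₃) :
    prob p ((connEvent ends a₁ a₂)ᶜ ∩ connEvent ends a₂ a₃) =
      mT (p eo) (p eb) (cellsOf p ends o a₁ a₂ b eo eb) := by
  set p00 := Function.update (Function.update p eo 0) eb 0 with hp00
  have key := prob_twoPin p h.ne ((connEvent ends a₁ a₂)ᶜ ∩ connEvent ends a₂ a₃)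
    (((connEvent ends a₁ a₂)ᶜ ∩ connEvent ends a₂ o ∩ (connEvent ends a₁ b)ᶜ) ∪
      ((connEvent ends a₁ a₂)ᶜ ∩ (connEvent ends a₁ o ∪ connEvent ends a₂ o)ᶜ ∩ connEvent ends a₂ b))
    ((connEvent ends a₁ a₂)ᶜ ∩ connEvent ends a₂ o) ((connEvent ends a₁ a₂)ᶜ ∩ connEvent ends a₂ b)
    ∅ ?_ ?_ ?_ ?_
  · rw [key]
    unfold mT cellsOf
    dsimp only
    rw [← hp00, prob_empty]
    have d : Disjoint ((connEvent ends a₁ a₂)ᶜ ∩ connEvent ends a₂ o ∩ (connEvent ends a₁ b)ᶜ)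
        ((connEvent ends a₁ a₂)ᶜ ∩ (connEvent ends a₁ o ∪ connEvent ends a₂ o)ᶜ ∩ connEvent ends a₂ b) :=
      Set.disjoint_left.2 fun ω h1 h2 => h2.1.2 (Or.inr h1.1.2)
    rw [prob_union_of_disjoint p00 d]
    have c := prob_inter_add_prob_inter_compl p00 ((connEvent ends a₁ a₂)ᶜ ∩ connEvent ends a₂ o)
      (connEvent ends a₁ b)
    have sb := split_b p00 ends b a₁ a₂ (connEvent ends a₂ o)
    have so := split_o p00 ends o a₁ a₂ (connEvent ends a₂ b)
    linear_combination (p eo * p eb) * c + p eo * sb + ((1 - p eo) * p eb) * so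
  · intro ω ho hb
    rw [openCC_tt ho hb]
    simp only [Set.mem_compl_iff, Set.mem_inter_iff, Set.mem_union, mem_connEvent]
    rw [conn_both_iff h ω h1 h2, conn_both_a3_iff h ω h2, base2_eq_self ho hb,
      conn_comm_iff ω b a₂, conn_comm_iff ω o a₂]
    have t1 : Conn ends ω a₁ o → Conn ends ω a₂ o → Conn ends ω a₁ a₂ :=
      fun x y => conn_trans x (conn_symm y)
    have t2 : Conn ends ω a₁ b → Conn ends ω a₂ b → Conn ends ω a₁ a₂ :=
      fun x y => conn_trans x (conn_symm y)
    tauto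
  · intro ω ho hb
    rw [openCC_tf h.ne ho hb]
    simp only [Set.mem_compl_iff, Set.mem_inter_iff, mem_connEvent]
    rw [conn_open_o_iff h ω h1 h2, conn_open_o_a3_iff h ω h2, base2_eq_self ho hb]
  · intro ω ho hb
    rw [openCC_ft ho hb]
    simp only [Set.mem_compl_iff, Set.mem_inter_iff, mem_connEvent]
    rw [conn_open_b_iff h ω h1 h2, conn_open_b_a3_iff h ω h2, base2_eq_self ho hb]
  · intro ω ho hb
    rw [openCC_ff ho hb]
    simp only [Set.mem_compl_iff, Set.mem_inter_iff, mem_connEvent, Set.mem_empty_iff_false,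
      iff_false, not_and]
    exact fun _ hc => not_conn_base2 h ω h2 hc

/-- **`P(T, b ∈ L)`** for `a₃ ~ {o, b}`: `r₁ (1 − r₂) HL`. -/
theorem mass_TbL (p : E → R) (h : IsTwoMarkAt ends o b a₃ eo eb) {a₁ a₂ : V} (h1 : a₁ ≠ a₃)
    (h2 : a₂ ≠ a₃) :
    prob p ((connEvent ends a₁ a₂)ᶜ ∩ connEvent ends a₂ a₃ ∩ connEvent ends a₁ b) =
      mTbL (p eo) (p eb) (cellsOf p ends o a₁ a₂ b eo eb) := by
  set p00 := Function.update (Function.update p eo 0) eb 0 with hp00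
  have key := prob_twoPin p h.ne ((connEvent ends a₁ a₂)ᶜ ∩ connEvent ends a₂ a₃ ∩ connEvent ends a₁ b)
    ∅ ((connEvent ends a₁ a₂)ᶜ ∩ connEvent ends a₂ o ∩ connEvent ends a₁ b) ∅ ∅ ?_ ?_ ?_ ?_
  · rw [key]
    unfold mTbL cellsOf
    dsimp only
    rw [← hp00, prob_empty]
    ring
  · intro ω ho hb
    rw [openCC_tt ho hb]
    simp only [Set.mem_compl_iff, Set.mem_inter_iff, mem_connEvent, Set.mem_empty_iff_false,
      iff_false]
    rw [conn_both_iff h ω h1 h2, conn_both_a3_iff h ω h2, conn_both_iff h ω h1 h.ne_b,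
      base2_eq_self ho hb, conn_comm_iff ω b a₂, conn_comm_iff ω o a₂]
    have hbb := conn_refl ends ω b
    have t1 : Conn ends ω a₁ o → Conn ends ω a₂ o → Conn ends ω a₁ a₂ :=
      fun x y => conn_trans x (conn_symm y)
    have t2 : Conn ends ω a₁ b → Conn ends ω a₂ b → Conn ends ω a₁ a₂ :=
      fun x y => conn_trans x (conn_symm y)
    tauto
  · intro ω ho hb
    rw [openCC_tf h.ne ho hb]
    simp only [Set.mem_compl_iff, Set.mem_inter_iff, mem_connEvent]
    rw [conn_open_o_iff h ω h1 h2, conn_open_o_a3_iff h ω h2, conn_open_o_iff h ω h1 h.ne_b,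
      base2_eq_self ho hb]
  · intro ω ho hb
    rw [openCC_ft ho hb]
    simp only [Set.mem_compl_iff, Set.mem_inter_iff, mem_connEvent, Set.mem_empty_iff_false,
      iff_false]
    rw [conn_open_b_iff h ω h1 h2, conn_open_b_a3_iff h ω h2, conn_open_b_iff h ω h1 h.ne_b,
      base2_eq_self ho hb]
    exact fun hc => hc.1.1 (conn_trans hc.2 (conn_symm hc.1.2))
  · intro ω ho hb
    rw [openCC_ff ho hb]
    simp only [Set.mem_compl_iff, Set.mem_inter_iff, mem_connEvent, Set.mem_empty_iff_false,
      iff_false]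
    exact fun hc => not_conn_base2 h ω h2 hc.1.2

/-- **`P(T, b ∈ L, o ∈ U) = P(T, b ∈ L)`** for `a₃ ~ {o, b}` (on `T ∩ {b ∈ L}` the cluster of `a₂` reaches `a₃`
through `o`). -/
theorem mass_TbLoU (p : E → R) (h : IsTwoMarkAt ends o b a₃ eo eb) {a₁ a₂ : V} (h1 : a₁ ≠ a₃)
    (h2 : a₂ ≠ a₃) :
    prob p ((connEvent ends a₁ a₂)ᶜ ∩ connEvent ends a₂ a₃ ∩ connEvent ends a₁ b ∩
        (connEvent ends a₁ o ∪ connEvent ends a₂ o)) =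
      mTbLoU (p eo) (p eb) (cellsOf p ends o a₁ a₂ b eo eb) := by
  set p00 := Function.update (Function.update p eo 0) eb 0 with hp00
  have key := prob_twoPin p h.ne ((connEvent ends a₁ a₂)ᶜ ∩ connEvent ends a₂ a₃ ∩ connEvent ends a₁ b ∩
        (connEvent ends a₁ o ∪ connEvent ends a₂ o))
    ∅ ((connEvent ends a₁ a₂)ᶜ ∩ connEvent ends a₂ o ∩ connEvent ends a₁ b) ∅ ∅ ?_ ?_ ?_ ?_
  · rw [key]
    unfold mTbLoU cellsOf
    dsimp only
    rw [← hp00, prob_empty]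
    ring
  · intro ω ho hb
    rw [openCC_tt ho hb]
    simp only [Set.mem_compl_iff, Set.mem_inter_iff, Set.mem_union, mem_connEvent,
      Set.mem_empty_iff_false, iff_false]
    rw [conn_both_iff h ω h1 h2, conn_both_a3_iff h ω h2, conn_both_iff h ω h1 h.ne_b,
      conn_both_iff h ω h1 h.ne_o, conn_both_iff h ω h2 h.ne_o,
      base2_eq_self ho hb, conn_comm_iff ω b a₂, conn_comm_iff ω o a₂]
    have hbb := conn_refl ends ω b
    have t1 : Conn ends ω a₁ o → Conn ends ω a₂ o → Conn ends ω a₁ a₂ :=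
      fun x y => conn_trans x (conn_symm y)
    have t2 : Conn ends ω a₁ b → Conn ends ω a₂ b → Conn ends ω a₁ a₂ :=
      fun x y => conn_trans x (conn_symm y)
    tauto
  · intro ω ho hb
    rw [openCC_tf h.ne ho hb]
    simp only [Set.mem_compl_iff, Set.mem_inter_iff, Set.mem_union, mem_connEvent]
    rw [conn_open_o_iff h ω h1 h2, conn_open_o_a3_iff h ω h2, conn_open_o_iff h ω h1 h.ne_b,
      conn_open_o_iff h ω h1 h.ne_o, conn_open_o_iff h ω h2 h.ne_o, base2_eq_self ho hb]
    tauto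
  · intro ω ho hb
    rw [openCC_ft ho hb]
    simp only [Set.mem_compl_iff, Set.mem_inter_iff, Set.mem_union, mem_connEvent,
      Set.mem_empty_iff_false, iff_false]
    rw [conn_open_b_iff h ω h1 h2, conn_open_b_a3_iff h ω h2, conn_open_b_iff h ω h1 h.ne_b,
      base2_eq_self ho hb]
    exact fun hc => hc.1.1.1 (conn_trans hc.1.2 (conn_symm hc.1.1.2))
  · intro ω ho hb
    rw [openCC_ff ho hb]
    simp only [Set.mem_compl_iff, Set.mem_inter_iff, Set.mem_union, mem_connEvent,
      Set.mem_empty_iff_false, iff_false]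
    exact fun hc => not_conn_base2 h ω h2 hc.1.1.2

end Masses

end HalfLTwoMark

end Summit.Ventures.PercRepro2
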